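import Literature.AlgebraicGeometry.Frobenioids.Thm42Sub
import HarnessLib

/-!
# [FrdI] Theorem 4.9 (Category-theoreticity of Divisor Monoids): the printed proof cut into named
# sub-lemmas (S5 sub-DAG, rows T49-L01…L08) — statements

Mochizuki, *The geometry of Frobenioids I: the general theory*, Kyushu J. Math. **62** (2008)
293–400, §4, Theorem 4.9, statement p. 88 l. 33 – p. 89 l. 2, proof p. 89 l. 3 – p. 90 l. 54
[cite: MochizukiFrdI2008, Thm. 4.9 p.88] (render `paper:url-bbf705efa10f`).

STATEMENTS-ONLY companion of `Thm42Sub.lean` (same conventions: named `Prop`s over the tree's Def. 1.3 API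
and the hypothesis structure `FrdI.T42.Setting`; nothing asserted; holder abc-iut-L1-t14; closing type of
Thm. 4.9 itself = `PreFrobenioidData.Thm49`, `DivisorMonoidCategoryTheoreticity.lean`, seat abc-iut-L1-t3).
Typed here: the local notion of the proof, **twin-primary steps** (p. 89 l. 47 – p. 90 l. 1:
"pairs of primary steps `β : A → B`, `γ : C → A` such that `Div(β) = (Φ_i(γ))⁻¹(Div(γ))`"), the predicate
"the right-hand and left-hand isomorphisms of Thm. 4.2 (iii) coincide at `(A, 𝔭)`" (`RightEqLeftAt`), and
rows T49-L02 (`SufficesRightEqLeft`), T49-L06 (`TwinPrimaryCriterion`), T49-L08 (`PsiPreservesTwinPrimary`).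
Rows T49-L01 (isotropic / non-group-like WLOG, Thm. 3.4 (i)(ii), Rmk. 4.5.1), L03 (`Φ ⊆ Φ^pf_factor`
preserved), L04 (functoriality along pull-backs, Prop. 1.11 (v)), L05 (perfect + strictly-rational WLOG,
Prop. 5.5 (iii), Prop. 1.11 (v)) and L07 (twin-primary witnesses from the strict rationality of `A`,
Def. 4.5 (ii), via the two cartesian squares of Prop. 4.1 (iii)) are recorded below as located notes: their
faithful statements need the birationalization / `Φ^birat` / `Supp` vocabulary of Def. 4.5 (ii)(iii)
(`BiratData.phiBirat`, `RSParams`; instantiated by seat abc-iut-L6-t8's construction) and are typed in a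
follow-up once that instantiation is fixed (row notes give the printed content verbatim).
-/

namespace Literature.AlgebraicGeometry.Frobenioids

open CategoryTheory Opposite

namespace FrdI.T49

universe w v v' u u'

variable {D₁ : Type u} [Category.{v} D₁] {Φ₁ : D₁ᵒᵖ ⥤ CommMonCat.{w}} {C₁ : Type u'} [Category.{v'} C₁]
  {D₂ : Type u} [Category.{v} D₂] {Φ₂ : D₂ᵒᵖ ⥤ CommMonCat.{w}} {C₂ : Type u'} [Category.{v'} C₂]

/-- **Twin-primary steps** (p. 89 l. 47 – p. 90 l. 1): "pairs of primary steps `β : A → B`, `γ : C → A` such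
that `Div(β) = (Φ(γ))⁻¹(Div(γ))`" [`= γ_*Div(γ) ∈ Φ(A)`]. [cite: MochizukiFrdI2008, Thm. 4.9 p.90] -/
def IsTwinPrimary {D : Type u} [Category.{v} D] {Φ : Dᵒᵖ ⥤ CommMonCat.{w}} {C : Type u'} [Category.{v'} C]
    (F : C ⥤ ElemFrobenioid Φ) {A B C' : C} (β : A ⟶ B) (γ : C' ⟶ A) : Prop :=
  PreFrobenioid.IsStep F β ∧ PreFrobenioid.IsPrimaryPreStep F β ∧ PreFrobenioid.IsStep F γ ∧
    PreFrobenioid.IsPrimaryPreStep F γ ∧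
      ∀ h : PreFrobenioid.IsBaseIso F γ, PreFrobenioid.Div F β = PreFrobenioid.invDiv F γ h

/-- "The right-hand and left-hand isomorphisms of Theorem 4.2, (iii), coincide" at `(A, 𝔭, 𝔭')` (p. 89
ll. 6–9): ONE isomorphism of monoids `Φ₁(A)_𝔭 ≃* Φ₂(Ψ A)_𝔭'` computing both `Div(Ψ φ)` for co-angular
pre-steps `φ` out of `A` (right-hand) and `(Ψψ)_*Div(Ψψ)` for co-angular pre-steps `ψ` into `A`
(left-hand). [cite: MochizukiFrdI2008, Thm. 4.9 p.89] -/
def RightEqLeftAt (F₁ : C₁ ⥤ ElemFrobenioid Φ₁) (F₂ : C₂ ⥤ ElemFrobenioid Φ₂) (Ψ : C₁ ≌ C₂) (A : C₁)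
    (𝔭 : Primes (Φ₁.obj (op (PreFrobenioid.baseObj F₁ A))))
    (𝔭' : Primes (Φ₂.obj (op (PreFrobenioid.baseObj F₂ (Ψ.functor.obj A))))) : Prop :=
  ∃ m : 𝔭.submonoid ≃* 𝔭'.submonoid,
    (∀ ⦃B : C₁⦄ (φ : A ⟶ B), PreFrobenioid.IsCoAngularPreStep F₁ φ →
        ∀ h : PreFrobenioid.Div F₁ φ ∈ 𝔭.submonoid,
          (m ⟨PreFrobenioid.Div F₁ φ, h⟩ : Φ₂.obj (op (PreFrobenioid.baseObj F₂ (Ψ.functor.obj A)))) =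
            PreFrobenioid.Div F₂ (Ψ.functor.map φ)) ∧
    ∀ ⦃B : C₁⦄ (ψ : B ⟶ A), PreFrobenioid.IsCoAngularPreStep F₁ ψ →
      ∀ (y : Φ₁.obj (op (PreFrobenioid.baseObj F₁ A))) (h : y ∈ 𝔭.submonoid),
        pull Φ₁ (PreFrobenioid.Base F₁ ψ) y = PreFrobenioid.Div F₁ ψ →
          pull Φ₂ (PreFrobenioid.Base F₂ (Ψ.functor.map ψ))
              (m ⟨y, h⟩ : Φ₂.obj (op (PreFrobenioid.baseObj F₂ (Ψ.functor.obj A)))) =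
            PreFrobenioid.Div F₂ (Ψ.functor.map ψ)

/-! ## `FrdI:Thm4.9/T49-L01` — noted (p. 89 ll. 3–5)
"we may assume without loss of generality that `C₁`, `C₂` are of isotropic type [Thm. 3.4 (i)(ii);
Rmk. 4.5.1], but not of group-like type [since Theorem 4.9 is vacuous if `C₁`, `C₂` are of group-like type]."
Reduction through the isotropification `C^istr` (Thm. 3.4 (i), seat abc-iut-L1-t13) and Rmk. 4.5.1; its
formal statement needs the `RSParams` of Def. 4.5 (iii) and is typed with row L03. OPEN. -/

/-- **T49-L02** `SufficesRightEqLeft` (p. 89 ll. 6–36): "it suffices to show that the right-hand and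
left-hand isomorphisms of Theorem 4.2, (iii), coincide for all universally Div-Frobenius-trivial objects
… then … `Ψ^Prime` extends … to an isomorphism of monoids `Φ₁(A₁)^pf_𝔭₁ ≅ Φ₂(A₂)^pf_𝔭₂` functorial in
`A₁` … [hence] `Φ₁(A₁)^pf_factor ≅ Φ₂(A₂)^pf_factor` … [and, via pre-steps with prescribed zero divisor,
Def. 1.3 (iii)(d)] an isomorphism of monoids `Φ₁(A₁) ≅ Φ₂(A₂)` which is functorial in `A₁` [on
`C^bs-iso`] … [and] with respect to pull-back morphisms [Prop. 1.11 (v)]". Rendered (perfect-type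
setting, given the family `e` of Thm. 4.2 (ii)): coincidence at every universally Div-Frobenius-trivial
`A` and every `𝔭` ⇒ a family of monoid isomorphisms `m_A : Φ₁(A) ≃* Φ₂(Ψ A)` over ALL objects computing
`Div(Ψ φ) = m_A(Div φ)` for pre-steps `φ` out of `A` and compatible with `Base(−)^*` along arbitrary
morphisms (functoriality on `C₁`). [cite: MochizukiFrdI2008, Thm. 4.9 p.89] -/
def SufficesRightEqLeft : Prop :=
  ∀ {D₁ : Type u} [Category.{v} D₁] {Φ₁ : D₁ᵒᵖ ⥤ CommMonCat.{w}} {C₁ : Type u'} [Category.{v'} C₁]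
    {D₂ : Type u} [Category.{v} D₂] {Φ₂ : D₂ᵒᵖ ⥤ CommMonCat.{w}} {C₂ : Type u'} [Category.{v'} C₂]
    (F₁ : C₁ ⥤ ElemFrobenioid Φ₁) (F₂ : C₂ ⥤ ElemFrobenioid Φ₂) (Ψ : C₁ ≌ C₂), T42.Setting F₁ F₂ Ψ →
    (∀ ⦃X Y : C₁⦄ (φ : X ⟶ Y), PreFrobenioid.IsPrimaryPreStep F₁ φ →
        PreFrobenioid.IsPrimaryPreStep F₂ (Ψ.functor.map φ)) →
    (∀ ⦃X Y : C₂⦄ (φ : X ⟶ Y), PreFrobenioid.IsPrimaryPreStep F₂ φ →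
        PreFrobenioid.IsPrimaryPreStep F₁ (Ψ.inverse.map φ)) →
    ∀ (e : ∀ A : C₁, Primes (Φ₁.obj (op (PreFrobenioid.baseObj F₁ A))) ≃
        Primes (Φ₂.obj (op (PreFrobenioid.baseObj F₂ (Ψ.functor.obj A))))),
      (∀ (A : C₁) ⦃E : C₁⦄ (ε : E ⟶ A) (hε : PreFrobenioid.IsPrimaryPreStep F₁ ε)
          (𝔭 : Primes (Φ₁.obj (op (PreFrobenioid.baseObj F₁ A)))),
          PreFrobenioid.invDiv F₁ ε hε.1.2 ∈ 𝔭.carrier →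
            ∀ h₂ : PreFrobenioid.IsBaseIso F₂ (Ψ.functor.map ε),
              PreFrobenioid.invDiv F₂ (Ψ.functor.map ε) h₂ ∈ (e A 𝔭).carrier) →
      (∀ (A : C₁), PreFrobenioid.IsUniversallyDivFrobeniusTrivial F₁ A →
          ∀ 𝔭 : Primes (Φ₁.obj (op (PreFrobenioid.baseObj F₁ A))), RightEqLeftAt F₁ F₂ Ψ A 𝔭 (e A 𝔭)) →
      ∃ m : ∀ A : C₁, Φ₁.obj (op (PreFrobenioid.baseObj F₁ A)) ≃* Φ₂.obj (op (PreFrobenioid.baseObj F₂ (Ψ.functor.obj A))),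
        (∀ ⦃A B : C₁⦄ (φ : A ⟶ B), PreFrobenioid.IsPreStep F₁ φ →
            m A (PreFrobenioid.Div F₁ φ) = PreFrobenioid.Div F₂ (Ψ.functor.map φ)) ∧
        ∀ ⦃A B : C₁⦄ (φ : A ⟶ B) (x : Φ₁.obj (op (PreFrobenioid.baseObj F₁ B))),
          m A (pull Φ₁ (PreFrobenioid.Base F₁ φ) x) = pull Φ₂ (PreFrobenioid.Base F₂ (Ψ.functor.map φ)) (m B x)

/-! ## `FrdI:Thm4.9/T49-L03` — noted (p. 89 ll. 25–33)
"by applying … the first equivalence of categories of Definition 1.3, (iii), (d), to obtain pre-steps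
`φ : A → B` with arbitrary prescribed zero divisor and considering primary steps `ψ : A → C` such that
`φ = ζ ∘ ψ` for some pre-step `ζ`, one concludes immediately that [the factorial isomorphism] maps the subset
`Φ₁(A₁) ⊆ Φ₁(A₁)^pf_factor` onto the subset `Φ₂(A₂) ⊆ Φ₂(A₂)^pf_factor`". Sub-step of row L02 (the
statement over `Φ^pf_factor`, Def. 2.4 (i)(c), `PerfFactorial.lean`'s `factorMap`); OPEN. -/

/-! ## `FrdI:Thm4.9/T49-L04` — noted (p. 89 ll. 33–36)
"the functoriality of this isomorphism of monoids with respect to pull-back morphisms follows immediately by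
“pulling back pre-steps”, as in Proposition 1.11, (v)" — the second clause of `SufficesRightEqLeft`'s
conclusion; OPEN (Prop. 1.11 (v), seat abc-iut-L1-t1). -/

/-! ## `FrdI:Thm4.9/T49-L05` — noted (p. 89 ll. 38–46)
"by passing to perfections [Thm. 3.4 (iii)], we may assume without loss of generality that `C₁`, `C₂` are of
perfect type [cf. also Proposition 5.5, (iii)] … Since the right-hand and left-hand isomorphisms … are
clearly compatible with pull-back morphisms [Prop. 1.11 (v)] and `Ψ` preserves pull-back morphisms
[Thm. 3.4 (iii)], … we may assume without loss of generality that `A` is strictly rational" (Def. 4.5 (ii)).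
Reduction: formal transport as in `FrdI.T42.PerfectWLOG` + `RightEqLeftAt` along a pull-back morphism
`A' → A` with `A'` strictly rational (universally Div-Frobenius-trivial `A` ⇒ `A'` Div-Frobenius-trivial);
the strict-rationality vocabulary is `PreFrobenioidData.IsStrictlyRational B Supp` (Def. 4.5 (ii)). OPEN. -/

/-- **T49-L06** `TwinPrimaryCriterion` (p. 90 ll. 1–4): "it suffices to show, for each
`𝔭 ∈ Prime(Φ₁(A))`, the existence of twin-primary steps with zero divisor in `𝔭` that are mapped by `Ψ` to
twin-primary steps of `C₂`" — i.e. such a witness forces the right-hand and left-hand isomorphisms of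
Thm. 4.2 (iii) at `(A, 𝔭)` (row T42-L12) to coincide. [cite: MochizukiFrdI2008, Thm. 4.9 p.90] -/
def TwinPrimaryCriterion : Prop :=
  ∀ {D₁ : Type u} [Category.{v} D₁] {Φ₁ : D₁ᵒᵖ ⥤ CommMonCat.{w}} {C₁ : Type u'} [Category.{v'} C₁]
    {D₂ : Type u} [Category.{v} D₂] {Φ₂ : D₂ᵒᵖ ⥤ CommMonCat.{w}} {C₂ : Type u'} [Category.{v'} C₂]
    (F₁ : C₁ ⥤ ElemFrobenioid Φ₁) (F₂ : C₂ ⥤ ElemFrobenioid Φ₂) (Ψ : C₁ ≌ C₂), T42.Setting F₁ F₂ Ψ →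
    ∀ {A : C₁}, PreFrobenioid.IsDivFrobeniusTrivial F₁ A →
      (∀ α : A ⟶ A, PreFrobenioid.IsDivIdentity F₁ α → PreFrobenioid.IsDivIdentity F₂ (Ψ.functor.map α)) →
      ∀ (𝔭 : Primes (Φ₁.obj (op (PreFrobenioid.baseObj F₁ A))))
        (𝔭' : Primes (Φ₂.obj (op (PreFrobenioid.baseObj F₂ (Ψ.functor.obj A))))),
        (∀ ⦃B : C₁⦄ (φ : A ⟶ B), PreFrobenioid.IsCoAngularPreStep F₁ φ →
            (PreFrobenioid.Div F₁ φ ∈ 𝔭.submonoid ↔ PreFrobenioid.Div F₂ (Ψ.functor.map φ) ∈ 𝔭'.submonoid)) →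
        (∀ ⦃B : C₁⦄ (ψ : B ⟶ A), PreFrobenioid.IsCoAngularPreStep F₁ ψ →
            ((∃ y ∈ 𝔭.submonoid, pull Φ₁ (PreFrobenioid.Base F₁ ψ) y = PreFrobenioid.Div F₁ ψ) ↔
              ∃ y ∈ 𝔭'.submonoid,
                pull Φ₂ (PreFrobenioid.Base F₂ (Ψ.functor.map ψ)) y = PreFrobenioid.Div F₂ (Ψ.functor.map ψ))) →
        (∃ (B C' : C₁) (β : A ⟶ B) (γ : C' ⟶ A), IsTwinPrimary F₁ β γ ∧
            PreFrobenioid.Div F₁ β ∈ 𝔭.carrier ∧ IsTwinPrimary F₂ (Ψ.functor.map β) (Ψ.functor.map γ)) →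
          RightEqLeftAt F₁ F₂ Ψ A 𝔭 𝔭'

/-! ## `FrdI:Thm4.9/T49-L07` — noted (p. 90 ll. 5–45)
"since `A` is strictly rational, it follows [cf. Definition 4.5, (ii)] that there exist, for each
`𝔭 ∈ Prime(Φ_i(A))`, cartesian commutative diagrams of pre-steps as in Proposition 4.1, (iii),
[`C →γ' D`, `γ ↓`, `↓ δ`, `B →β A`] and [`C →γ' D`, `γ'' ↓`, `↓ δ'`, `A →α F`] in which `α`, `β` are
twin-primary with zero divisor in `𝔭`; the pre-steps `ζ := β ∘ γ : C → A`, `γ'' : C → A` are Div-equivalent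
[e.g., base-equivalent] … Conversely, given any [such] pair of cartesian diagrams … in which `α`, `β` are
primary with zero divisor in `𝔭` [and] `ζ`, `γ''` are Div-equivalent, it follows immediately that `α`, `β` are
twin-primary." Needs Def. 4.5 (ii) (`IsStrictlyRational B Supp`); OPEN (largest row). -/

/-- **T49-L08** `PsiPreservesTwinPrimary` (p. 90 ll. 46–53): "since `Ψ` preserves pre-steps [Thm. 3.4 (ii)],
primary steps [Thm. 4.2 (i)], Div-equivalent pairs of base-isomorphisms [Thm. 4.2 (ii); `Φ_i` non-dilating],
and cartesian diagrams as in Proposition 4.1, (iii) …, for each `𝔭` there exist twin-primary steps with zero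
divisor in `𝔭` that are mapped by `Ψ` to twin-primary steps" — the transport of twin-primary witnesses
presented by a pair of cartesian pre-step squares with Div-equivalent `β ∘ γ`, `γ''` (row L07: such
`α`, `β` are twin-primary, and so are their images).
[cite: MochizukiFrdI2008, Thm. 4.9 p.90] -/
def PsiPreservesTwinPrimary : Prop :=
  ∀ {D₁ : Type u} [Category.{v} D₁] {Φ₁ : D₁ᵒᵖ ⥤ CommMonCat.{w}} {C₁ : Type u'} [Category.{v'} C₁]
    {D₂ : Type u} [Category.{v} D₂] {Φ₂ : D₂ᵒᵖ ⥤ CommMonCat.{w}} {C₂ : Type u'} [Category.{v'} C₂]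
    (F₁ : C₁ ⥤ ElemFrobenioid Φ₁) (F₂ : C₂ ⥤ ElemFrobenioid Φ₂) (Ψ : C₁ ≌ C₂), T42.Setting F₁ F₂ Ψ →
    IsNonDilatingOn Φ₁ → IsNonDilatingOn Φ₂ →
    (∀ ⦃X Y : C₁⦄ (φ : X ⟶ Y), PreFrobenioid.IsPrimaryPreStep F₁ φ →
        PreFrobenioid.IsPrimaryPreStep F₂ (Ψ.functor.map φ)) →
    (∀ ⦃X Y : C₁⦄ (φ ψ : X ⟶ Y), PreFrobenioid.IsBaseIso F₁ φ → PreFrobenioid.IsBaseIso F₁ ψ →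
        PreFrobenioid.DivEquivalent F₁ φ ψ →
          PreFrobenioid.DivEquivalent F₂ (Ψ.functor.map φ) (Ψ.functor.map ψ)) →
    ∀ {A B C' D' F' : C₁} (α : A ⟶ F') (β : B ⟶ A) (γ : C' ⟶ B) (γ' : C' ⟶ D') (δ : D' ⟶ A)
      (γ'' : C' ⟶ A) (δ' : D' ⟶ F'),
      -- `α`, `β` primary steps with zero divisor in a common prime; all other arrows pre-steps
      PreFrobenioid.IsStep F₁ α → PreFrobenioid.IsPrimaryPreStep F₁ α →
      PreFrobenioid.IsStep F₁ β → PreFrobenioid.IsPrimaryPreStep F₁ β →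
      PreFrobenioid.IsPreStep F₁ γ → PreFrobenioid.IsPreStep F₁ γ' → PreFrobenioid.IsPreStep F₁ δ →
      PreFrobenioid.IsPreStep F₁ γ'' → PreFrobenioid.IsPreStep F₁ δ' →
      -- the two commutative squares `δ ∘ γ' = β ∘ γ`, `δ' ∘ γ' = α ∘ γ''`, cartesian among pre-steps
      γ' ≫ δ = γ ≫ β → γ' ≫ δ' = γ'' ≫ α →
      (∀ ⦃V : C₁⦄ (a : V ⟶ D') (b : V ⟶ B), PreFrobenioid.IsPreStep F₁ a → PreFrobenioid.IsPreStep F₁ b →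
          a ≫ δ = b ≫ β → ∃! u : V ⟶ C', u ≫ γ' = a ∧ u ≫ γ = b) →
      (∀ ⦃V : C₁⦄ (a : V ⟶ D') (b : V ⟶ A), PreFrobenioid.IsPreStep F₁ a → PreFrobenioid.IsPreStep F₁ b →
          a ≫ δ' = b ≫ α → ∃! u : V ⟶ C', u ≫ γ' = a ∧ u ≫ γ'' = b) →
      -- `ζ := β ∘ γ` and `γ''` Div-equivalent
      PreFrobenioid.DivEquivalent F₁ (γ ≫ β) γ'' →
        IsTwinPrimary F₁ α β ∧ IsTwinPrimary F₂ (Ψ.functor.map α) (Ψ.functor.map β)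

/-! ## `FrdI:Thm4.9/T49-L08` repaired form (finding T49-F1, seat abc-iut-w4-d105) -/

/-- **T49-L08, repaired** `PsiPreservesTwinPrimary'` (p. 90 ll. 28–53): as `PsiPreservesTwinPrimary`, with the
two squares required to be squares "AS IN Proposition 4.1, (iii)", i.e. over CO-PRIMARY pairs `(δ, β)` (over
`A`) and `(δ', α)` (over `F`) — "every pre-step through which both factor is an isomorphism" — the hypotheses
that make the squares carry the divisor identities `ε_*(ε'_*Div ε') = ι_*(Div ι)` of Prop. 4.1 (iii) on which
"it follows immediately that `α`, `β` are twin-primary" rests (finding T49-F1; GAP-LEDGER G-w4d105-1: the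
unprimed statement omits them and is not provable as typed). Closer:
`FrdI.T49.isTwinPrimary_map_of_coprimary_squares` (`TwinPrimaryTransport.lean`, seat abc-iut-w4-d105).
[cite: MochizukiFrdI2008, Thm. 4.9 p.90] -/
def PsiPreservesTwinPrimary' : Prop :=
  ∀ {D₁ : Type u} [Category.{v} D₁] {Φ₁ : D₁ᵒᵖ ⥤ CommMonCat.{w}} {C₁ : Type u'} [Category.{v'} C₁]
    {D₂ : Type u} [Category.{v} D₂] {Φ₂ : D₂ᵒᵖ ⥤ CommMonCat.{w}} {C₂ : Type u'} [Category.{v'} C₂]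
    (F₁ : C₁ ⥤ ElemFrobenioid Φ₁) (F₂ : C₂ ⥤ ElemFrobenioid Φ₂) (Ψ : C₁ ≌ C₂), T42.Setting F₁ F₂ Ψ →
    IsNonDilatingOn Φ₁ → IsNonDilatingOn Φ₂ →
    (∀ ⦃X Y : C₁⦄ (φ : X ⟶ Y), PreFrobenioid.IsPrimaryPreStep F₁ φ →
        PreFrobenioid.IsPrimaryPreStep F₂ (Ψ.functor.map φ)) →
    (∀ ⦃X Y : C₁⦄ (φ ψ : X ⟶ Y), PreFrobenioid.IsBaseIso F₁ φ → PreFrobenioid.IsBaseIso F₁ ψ →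
        PreFrobenioid.DivEquivalent F₁ φ ψ →
          PreFrobenioid.DivEquivalent F₂ (Ψ.functor.map φ) (Ψ.functor.map ψ)) →
    ∀ {A B C' D' F' : C₁} (α : A ⟶ F') (β : B ⟶ A) (γ : C' ⟶ B) (γ' : C' ⟶ D') (δ : D' ⟶ A)
      (γ'' : C' ⟶ A) (δ' : D' ⟶ F'),
      PreFrobenioid.IsStep F₁ α → PreFrobenioid.IsPrimaryPreStep F₁ α →
      PreFrobenioid.IsStep F₁ β → PreFrobenioid.IsPrimaryPreStep F₁ β →
      PreFrobenioid.IsPreStep F₁ γ → PreFrobenioid.IsPreStep F₁ γ' → PreFrobenioid.IsPreStep F₁ δ →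
      PreFrobenioid.IsPreStep F₁ γ'' → PreFrobenioid.IsPreStep F₁ δ' →
      γ' ≫ δ = γ ≫ β → γ' ≫ δ' = γ'' ≫ α →
      (∀ ⦃V : C₁⦄ (a : V ⟶ D') (b : V ⟶ B), PreFrobenioid.IsPreStep F₁ a → PreFrobenioid.IsPreStep F₁ b →
          a ≫ δ = b ≫ β → ∃! u : V ⟶ C', u ≫ γ' = a ∧ u ≫ γ = b) →
      (∀ ⦃V : C₁⦄ (a : V ⟶ D') (b : V ⟶ A), PreFrobenioid.IsPreStep F₁ a → PreFrobenioid.IsPreStep F₁ b →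
          a ≫ δ' = b ≫ α → ∃! u : V ⟶ C', u ≫ γ' = a ∧ u ≫ γ'' = b) →
      -- NEW (print: "as in Proposition 4.1, (iii)"): `(δ, β)` and `(δ', α)` are co-primary
      (∀ ⦃Z : C₁⦄ (ζ : Z ⟶ A), PreFrobenioid.IsPreStep F₁ ζ →
          (∃ (ε' : D' ⟶ Z) (ι' : B ⟶ Z), PreFrobenioid.IsPreStep F₁ ε' ∧ PreFrobenioid.IsPreStep F₁ ι' ∧
              ε' ≫ ζ = δ ∧ ι' ≫ ζ = β) → IsIso ζ) →
      (∀ ⦃Z : C₁⦄ (ζ : Z ⟶ F'), PreFrobenioid.IsPreStep F₁ ζ →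
          (∃ (ε' : D' ⟶ Z) (ι' : A ⟶ Z), PreFrobenioid.IsPreStep F₁ ε' ∧ PreFrobenioid.IsPreStep F₁ ι' ∧
              ε' ≫ ζ = δ' ∧ ι' ≫ ζ = α) → IsIso ζ) →
      PreFrobenioid.DivEquivalent F₁ (γ ≫ β) γ'' →
        IsTwinPrimary F₁ α β ∧ IsTwinPrimary F₂ (Ψ.functor.map α) (Ψ.functor.map β)

end FrdI.T49

end Literature.AlgebraicGeometry.Frobenioids
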